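import Literature.Topology.FourManifolds.RLinkSphereExistence
import HarnessLib

/-!
# Helper `helper_sphereExists` of line `sphere_split` (crux `VerlindeRLinks.VrlSliceRigidity`,
# item stmt-SmoothPoincare4-16179): every R-link has a closed manifold `Σ_L`

The rev-1 registered stub `stub_sphereExists` of the line (Gompf–Scharlemann–Thompson 2010, §9:
the closed `4`-manifold `W = D⁴ ∪_L (2-handles) ∪ ♮ⁿ(S¹ × B³)` of an R-link), which the lead's
skeleton rev 2 cut into the three known stubs T1 (trace exists), T2 (boundary of the trace is the
surgery), T3 (a `(1,n)`-handlebody with boundary `#ⁿ(S² × S¹)`) — all three LANDED on 2026-08-17 —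
and which is therefore now a THEOREM of the Literature,
`Literature.Topology.FourManifolds.exists_isRLinkSphere` (`RLinkSphereExistence.lean`).  Recorded
here verbatim in the stub's registered shape (the idle R-link instance hypotheses `CompactSpace`,
`ConnectedSpace` included) as a `--supports` helper of the crux item; it is the existence half of
what the route's deciding theorem needs from this crux (strategist's `closes_alt`:
`VrlSlideGap → sphereExists → stub_stdSphereSlides → ¬ SmoothPoincare4`).

## References

* R. E. Gompf, M. Scharlemann, A. Thompson, Geom. Topol. 14 (2010) 2305–2347, §9 (arXiv p. 19).
  [GompfScharlemannThompson2010]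
* R. C. Kirby, *The Topology of 4-Manifolds*, LNM 1374 (1989), Ch. I §2, p. 8. [Kirby1989]
-/

open scoped Manifold ContDiff Topology
open Set Function Literature.Topology.FourManifolds

noncomputable section

-- every `Summit.SmoothPoincare4.SmoothPoincare4.…` name repeats the summit = sub-problem segment
-- (D-0017 layout); the duplicate is deliberate.
set_option linter.dupNamespace false

namespace Summit.SmoothPoincare4.SmoothPoincare4.Theorems.VrlSliceRigidity.SphereSplit

/-- **Helper `helper_sphereExists` — every R-link has a closed manifold `Σ_L`**
(Gompf–Scharlemann–Thompson 2010, §9): if `Y ≅ #ⁿ(S² × S¹)` is integral surgery on the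
`n`-component framed link `L`, then some Hausdorff second countable smooth closed `4`-manifold
`X : Type` satisfies `IsRLinkSphere X L`.  The Literature theorem `exists_isRLinkSphere`, in the
registered shape of the line's rev-1 stub `stub_sphereExists`.
[cite: GompfScharlemannThompson2010, §9 (arXiv p. 19)] -/
theorem helper_sphereExists :
    ∀ (n : ℕ) (L : FramedLink (Fin n)) (Y : Type) [TopologicalSpace Y] [T2Space Y]
      [SecondCountableTopology Y] [ChartedSpace (EuclideanSpace ℝ (Fin 3)) Y]
      [IsManifold (𝓡 3) ∞ Y] [CompactSpace Y] [ConnectedSpace Y],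
      IsSphereTwoProdCircleSum n Y → L.IsSurgery (𝓡 3) Y →
        ∃ (X : Type) (_ : TopologicalSpace X) (_ : T2Space X) (_ : SecondCountableTopology X)
          (_ : ChartedSpace (EuclideanSpace ℝ (Fin 4)) X) (_ : IsManifold (𝓡 4) ∞ X),
          IsRLinkSphere X L :=
  fun _ L Y _ _ _ _ _ _ _ hY hL => exists_isRLinkSphere L Y hY hL

end Summit.SmoothPoincare4.SmoothPoincare4.Theorems.VrlSliceRigidity.SphereSplit

end
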